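import Literature.NumberTheory.QuadraticFields.ReducedQuadraticIrrationalsConvergents
import Mathlib.Analysis.SpecialFunctions.Log.Basic
import Mathlib.Tactic.IntervalCases
import HarnessLib

/-!
# The principal cycle of a real quadratic order and its fundamental unit

Topic `NumberTheory/QuadraticFields`; continues `ReducedQuadraticIrrationalsConvergents.lean`.
Theorem-and-definition file (no named facts). For a non-square `D ≡ 0, 1 (mod 4)` (a real
quadratic discriminant) the order `𝒪_D = [1, (D + √D)/2]` has the **principal cycle** of reduced
quotients: the purely periodic part `x₁, x₂, …, x_p` of the continued fraction expansion of
`δ = (q + √D)/2`, `q = D mod 2` (Jacobson–Williams, *Solving the Pell Equation*, §3.3 with `s = 2`;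
§5.3, the cycle of reduced principal ideals; Jozsa 2003, §6.3, Thm. 4). We define

* `principalStart D = (q, 2)` (`δ`, pre-reduced: `isPreReduced_principalStart`), the first reduced
  quotient `x₁ = step δ` and the period length `periodLength D = p`;
* `fundUnit D = ∏_{k=1}^{p} ψ_k` (op. cit. (5.33): `ε_Δ = θ_{p+1}`), and prove
* `fundUnit_eq_valProd : ε = ∏_{k=1}^{p} φ_k` (op. cit. (5.34), since `Q_p = Q_0`),
  `log_fundUnit : log ε = ∑_{k<p} log φ(step^k x₁)` (the regulator as the total Shanks distance
  around the principal cycle, Jozsa 2003 Thm. 4(b) / JW §7.4), `one_lt_fundUnit`, and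
* **`exists_fundUnit_eq`**: `ε = (G + B√D)/2` with integers `G, B ≥ 1`, `G² − DB² = ±4`, i.e.
  `ε` is a unit `> 1` of `𝒪_D` (op. cit. (3.18) with (5.33)).

The minimality of `ε` among the units `> 1` (op. cit. §3.3, pp. 58–59) is the sequel
`RealQuadraticFundamentalUnit.lean`.

## References

* M. J. Jacobson, Jr., H. C. Williams, *Solving the Pell Equation*, CMS Books in Mathematics,
  Springer (2009), §3.3 (pp. 58–59, δ = (q + √D)/s), §5.3 (5.32)–(5.34), §7.4. [JacobsonWilliams2008]
* R. Jozsa, *Notes on Hallgren's efficient quantum algorithm for solving Pell's equation*,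
  arXiv:quant-ph/0302134 (2003), §6.3 Thm. 4, §7 Prop. 31. [Jozsa2003]
-/

noncomputable section

open scoped Classical

namespace Literature.NumberTheory.QuadraticFields

namespace QuadIrr

variable {D : ℕ}

/-! ### The principal start `δ = (q + √D)/2` -/

/-- `δ = (q + √D)/2`, `q = D mod 2`: the generator datum of the order of discriminant `D`
(`𝒪_D = ℤ + δℤ`). [cite: JacobsonWilliams2008, §3.3 (δ = (q + √D)/s, p. 58)] -/
def principalStart (D : ℕ) : QuadIrr D := ⟨(D % 2 : ℕ), 2⟩

/-- The first reduced quotient `x₁ = step δ` of the principal cycle. [cite: JacobsonWilliams2008, §5.3 (the cycle (5.32) of reduced principal ideals)] -/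
def principalFirst (D : ℕ) : QuadIrr D := step (principalStart D)

/-- The period length `p` of the principal cycle. [cite: JacobsonWilliams2008, §3.3 (period length p of δ)] -/
def periodLength (D : ℕ) : ℕ := Function.minimalPeriod step (principalFirst D)

/-- **The fundamental unit** `ε = ∏_{k=1}^{p} ψ_k` of the order of discriminant `D`
(`ε_Δ = θ_{p+1}`). [cite: JacobsonWilliams2008, §5.3 (5.33)] -/
def fundUnit (D : ℕ) : ℝ := psiProd (principalStart D) (periodLength D)

/-- A non-square `D ≡ 0, 1 (mod 4)` is at least `5`. [folklore] -/
theorem five_le (hD : ¬ IsSquare D) (hD4 : D % 4 = 0 ∨ D % 4 = 1) : 5 ≤ D := by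
  by_contra h
  push Not at h
  interval_cases D
  · exact hD ⟨0, rfl⟩
  · exact hD ⟨1, rfl⟩
  · omega
  · omega
  · exact hD ⟨2, rfl⟩

/-- `2 < √D` for a non-square `D ≡ 0, 1 (mod 4)`. [folklore] -/
theorem two_lt_sqrt (hD : ¬ IsSquare D) (hD4 : D % 4 = 0 ∨ D % 4 = 1) : 2 < Real.sqrt D := by
  have h5 : (5 : ℝ) ≤ D := by exact_mod_cast five_le hD hD4
  rw [show (2 : ℝ) = Real.sqrt 4 by rw [show (4 : ℝ) = 2 ^ 2 by norm_num, Real.sqrt_sq (by norm_num)]]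
  exact Real.sqrt_lt_sqrt (by norm_num) (by linarith)

/-- `P₀ = q = D mod 2 ∈ {0, 1}` and `Q₀ = 2`. [cite: JacobsonWilliams2008, §3.3 (P_0 = q, Q_0 = s)] -/
theorem principalStart_P_Q : (principalStart D).P = (D % 2 : ℕ) ∧ (principalStart D).Q = 2 := ⟨rfl, rfl⟩

/-- **`δ` is pre-reduced** (`2 ∣ D − q²`, `δ > 1`, `δ̄ < 0`). [cite: JacobsonWilliams2008, §3.3 (φ_0 = δ > 1, δ̄ < 0, p. 59)] -/
theorem isPreReduced_principalStart (hD : ¬ IsSquare D) (hD4 : D % 4 = 0 ∨ D % 4 = 1) :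
    (principalStart D).IsPreReduced := by
  have hs := two_lt_sqrt hD hD4
  have hq : ((D % 2 : ℕ) : ℤ) = 0 ∨ ((D % 2 : ℕ) : ℤ) = 1 := by omega
  refine ⟨by simp [principalStart], ?_, ?_, ?_⟩
  · show (2 : ℤ) ∣ (D : ℤ) - ((D % 2 : ℕ) : ℤ) ^ 2
    have : ((D % 2 : ℕ) : ℤ) = (D : ℤ) % 2 := by push_cast; rfl
    rcases hq with h | h <;> rw [h] <;> omega
  · unfold val principalStart
    have hq' : (0 : ℝ) ≤ ((D % 2 : ℕ) : ℤ) := by positivity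
    push_cast at hq' ⊢
    rw [lt_div_iff₀ (by norm_num : (0 : ℝ) < 2)]
    linarith
  · unfold conj principalStart
    have hq' : (((D % 2 : ℕ) : ℤ) : ℝ) ≤ 1 := by
      have : ((D % 2 : ℕ) : ℤ) ≤ 1 := by omega
      exact_mod_cast this
    push_cast at hq' ⊢
    rw [div_neg_iff]
    right
    exact ⟨by linarith, by norm_num⟩

/-- `x₁` is reduced. [cite: JacobsonWilliams2008, §3.3 Prop. 3.4] -/
theorem isReduced_principalFirst (hD : ¬ IsSquare D) (hD4 : D % 4 = 0 ∨ D % 4 = 1) :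
    (principalFirst D).IsReduced :=
  (isPreReduced_principalStart hD hD4).isReduced_step hD

/-- The period length is positive. [cite: JacobsonWilliams2008, §3.3 (p ≥ 1)] -/
theorem periodLength_pos (hD : ¬ IsSquare D) (hD4 : D % 4 = 0 ∨ D % 4 = 1) : 0 < periodLength D :=
  minimalPeriod_pos hD (isReduced_principalFirst hD hD4)

/-- `x_{p+1} = x₁`. [cite: JacobsonWilliams2008, §3.3 (φ_{p+1} = φ_1)] -/
theorem iterate_periodLength_principalFirst : step^[periodLength D] (principalFirst D) = principalFirst D :=
  Function.iterate_minimalPeriod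

/-- `x_k = step^{k}(δ)` is `step^{k-1}(x₁)`. [folklore] -/
theorem iterate_succ_principalStart (k : ℕ) :
    step^[k + 1] (principalStart D) = step^[k] (principalFirst D) := by
  rw [Function.iterate_succ_apply]; rfl

/-! ### `Q_p = Q_0` and `ε = ∏ φ_k` -/

/-- Two admissible quotients with the same step have the same `Q` (`Q = (D − P'²)/Q'`).
[cite: JacobsonWilliams2008, §5.3 (p. 111, a^* = −N(b + ω)/a)] -/
theorem Q_eq_of_step_eq (hD : ¬ IsSquare D) {x y : QuadIrr D} (hx : x.IsAdmissible) (hy : y.IsAdmissible)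
    (h : step x = step y) : x.Q = y.Q := by
  have h1 := step_Q_mul_Q hx
  have h2 := step_Q_mul_Q hy
  rw [h] at h1
  have hQ0 : (step y).Q ≠ 0 := (isAdmissible_step hD hy).1
  exact mul_left_cancel₀ hQ0 (h1.trans h2.symm)

/-- **`Q_p = Q_0 = 2`**: the last quotient of the principal cycle has denominator `2`.
[cite: JacobsonWilliams2008, §3.3 (Q_{n+1} = s, p. 59)] -/
theorem Q_iterate_periodLength (hD : ¬ IsSquare D) (hD4 : D % 4 = 0 ∨ D % 4 = 1) :
    (step^[periodLength D] (principalStart D)).Q = 2 := by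
  have hp := periodLength_pos hD hD4
  obtain ⟨m, hm⟩ : ∃ m, periodLength D = m + 1 := ⟨periodLength D - 1, by omega⟩
  have hadm0 := (isPreReduced_principalStart hD hD4).isAdmissible
  have hadm : (step^[periodLength D] (principalStart D)).IsAdmissible := isAdmissible_iterate hD hadm0 _
  have hstep : step (step^[periodLength D] (principalStart D)) = step (principalStart D) := by
    rw [← Function.iterate_succ_apply' (f := step), hm, iterate_succ_principalStart, ← hm]
    exact iterate_periodLength_principalFirst
  rw [Q_eq_of_step_eq hD hadm hadm0 hstep]
  rfl

/-- **`ε = ∏_{k=1}^{p} φ_k`**: the fundamental unit is the product of the complete quotients over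
the principal cycle. [cite: JacobsonWilliams2008, §5.3 (5.34)] -/
theorem fundUnit_eq_valProd (hD : ¬ IsSquare D) (hD4 : D % 4 = 0 ∨ D % 4 = 1) :
    fundUnit D = valProd (principalStart D) (periodLength D) := by
  have h0 := isPreReduced_principalStart hD hD4
  rw [fundUnit, psiProd_eq hD h0.isAdmissible (h0.isReduced_iterate_succ hD), Q_iterate_periodLength hD hD4]
  simp [principalStart]

/-- `ε > 1`. [cite: JacobsonWilliams2008, §4.3 (ε_Δ > 1)] -/
theorem one_lt_fundUnit (hD : ¬ IsSquare D) (hD4 : D % 4 = 0 ∨ D % 4 = 1) : 1 < fundUnit D := by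
  have hp := periodLength_pos hD hD4
  obtain ⟨m, hm⟩ : ∃ m, periodLength D = m + 1 := ⟨periodLength D - 1, by omega⟩
  rw [fundUnit, hm]
  exact (isPreReduced_principalStart hD hD4).one_lt_psiProd_succ hD m

/-- **The regulator as the distance around the principal cycle**:
`log ε = ∑_{k<p} log φ(step^k x₁)` (each `φ > 1`). [cite: Jozsa2003, §6.3 Thm. 4(b) and §7 (δ(J_i, ρ J_i) = ln γ_i)] -/
theorem log_fundUnit (hD : ¬ IsSquare D) (hD4 : D % 4 = 0 ∨ D % 4 = 1) :
    Real.log (fundUnit D) =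
      ∑ k ∈ Finset.range (periodLength D), Real.log ((step^[k] (principalFirst D)).val) := by
  rw [fundUnit_eq_valProd hD hD4, valProd, Real.log_prod]
  · simp only [iterate_succ_principalStart]
  · intro k _
    rw [iterate_succ_principalStart]
    have := (isReduced_iterate hD (isReduced_principalFirst hD hD4) k).2.2.1
    exact (by linarith : (step^[k] (principalFirst D)).val ≠ 0)

/-! ### `ε = (G + B√D)/2` with `G² − DB² = ±4` -/

/-- The norm of the fundamental unit: `ε · ∏_{k=1}^{p} ψ̄_k = (−1)^p`. [cite: JacobsonWilliams2008, §3.1 (3.18) with §5.3 (5.33)] -/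
theorem fundUnit_mul_psiBarProd (hD : ¬ IsSquare D) (hD4 : D % 4 = 0 ∨ D % 4 = 1) :
    fundUnit D * psiBarProd (principalStart D) (periodLength D) = (-1) ^ periodLength D := by
  rw [fundUnit, psiProd_mul_psiBarProd hD (isPreReduced_principalStart hD hD4).isAdmissible,
    Q_iterate_periodLength hD hD4]
  simp [principalStart]

/-- **The fundamental unit is `(G + B√D)/2` with integers `G, B ≥ 1` and `G² − DB² = ±4`**; its
conjugate `(G − B√D)/2` is `∏ ψ̄_k`, of absolute value `1/ε`. Here `(A, B) = (A_{p-1}, B_{p-1})`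
is the `(p−1)`-st convergent of `δ` and `G = 2A − qB` (op. cit. (3.8): `G_j = Q_0 A_j − P_0 B_j`).
[cite: JacobsonWilliams2008, §3.3 (ε = (G_{p-1} + √D B_{p-1})/s, p. 59) with (3.18)] -/
theorem exists_fundUnit_eq (hD : ¬ IsSquare D) (hD4 : D % 4 = 0 ∨ D % 4 = 1) :
    ∃ G B : ℤ, 1 ≤ G ∧ 1 ≤ B ∧
      (G ^ 2 - D * B ^ 2 = 4 ∨ G ^ 2 - D * B ^ 2 = -4) ∧
      fundUnit D = (G + B * Real.sqrt D) / 2 ∧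
      psiBarProd (principalStart D) (periodLength D) = (G - B * Real.sqrt D) / 2 := by
  have h0 := isPreReduced_principalStart hD hD4
  have hp := periodLength_pos hD hD4
  obtain ⟨m, hm⟩ : ∃ m, periodLength D = m + 1 := ⟨periodLength D - 1, by omega⟩
  set c := (principalStart D).val.convergent m with hc
  have h1 := num_sub_den_mul_conj hD h0 m
  have h2 := num_sub_den_mul_val hD h0 m
  rw [← hc, ← hm] at h1 h2
  set q : ℤ := ((D % 2 : ℕ) : ℤ) with hq
  have hval : (principalStart D).val = (q + Real.sqrt D) / 2 := by
    unfold val principalStart; push_cast; rfl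
  have hconj : (principalStart D).conj = (q - Real.sqrt D) / 2 := by
    unfold conj principalStart; push_cast; rfl
  refine ⟨2 * c.num - q * c.den, c.den, ?_, ?_, ?_, ?_, ?_⟩
  · -- `G ≥ 1` from `G = ε + ε̄`, `ε > 1`, `|ε̄| < 1`
    have hε := one_lt_fundUnit hD hD4
    have hnorm := fundUnit_mul_psiBarProd hD hD4
    have hG : ((2 * c.num - q * c.den : ℤ) : ℝ) = fundUnit D + psiBarProd (principalStart D) (periodLength D) := by
      rw [fundUnit, ← h1, ← h2, hval, hconj]; push_cast; ring
    have habs : |psiBarProd (principalStart D) (periodLength D)| < 1 := by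
      have h3 : |fundUnit D * psiBarProd (principalStart D) (periodLength D)| = 1 := by
        rw [hnorm]; simp
      rw [abs_mul, abs_of_pos (by linarith)] at h3
      have : |psiBarProd (principalStart D) (periodLength D)| = 1 / fundUnit D := by
        field_simp; linarith
      rw [this, div_lt_one (by linarith)]
      exact hε
    have : (0 : ℝ) < ((2 * c.num - q * c.den : ℤ) : ℝ) := by
      rw [hG]; have := neg_abs_le (psiBarProd (principalStart D) (periodLength D)); linarith
    exact_mod_cast this
  · exact_mod_cast c.den_pos
  · -- the norm equation from `ε ε̄ = (−1)^p`
    have hnorm := fundUnit_mul_psiBarProd hD hD4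
    rw [fundUnit, ← h1, ← h2, hval, hconj] at hnorm
    have hs := sqrt_sq (D := D)
    have key : ((2 * c.num - q * c.den : ℤ) : ℝ) ^ 2 - D * (c.den : ℤ) ^ 2 = 4 * (-1) ^ periodLength D := by
      rw [← hnorm]; push_cast; linear_combination ((c.den : ℝ) ^ 2) * hs
    rcases neg_one_pow_eq_or ℝ (periodLength D) with h | h
    · left
      rw [h] at key
      exact_mod_cast key
    · right
      rw [h] at key
      exact_mod_cast key
  · rw [fundUnit, ← h1, hconj]; push_cast; ring
  · rw [← h2, hval]; push_cast; ring

end QuadIrr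

end Literature.NumberTheory.QuadraticFields

end
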